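import Mathlib
import Literature.NumberTheory.LFunctions.LittlewoodPsiOscillationRH
import Literature.NumberTheory.LFunctions.FordZetaZeroRecipSqSum
import HarnessLib

/-!
# The zero-phase sum of the floor law under RH: Dirichlet alignment makes `Re Σ_ρ m(ρ)e^{2aρ}/ρ²` reach `−σ·e^a` infinitely often

Helper file (`--supports stmt-RiemannHypothesis-0098`, lead-track anchor: Weil-positivity window ladder, format-C far bound),
pure proofs, imports only `Literature`.  Seat rh-explicit-weil-1 gen10 (memo `run/shared/lean/pub/rh-explicit/rh-explicit-weil-1/FORMAT-K3.md` §11.6–11.8).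
The residual of STRUCTURE.md law C-XIII for the cosh test is `−Z(a) + o(1)` with the ZERO SUM
`Z(a) = Re Σ_ρ m(ρ)(e^{2a})^ρ/ρ² / (2(a + sinh a))` (`WeilFarFloorCoshZeroSum`).  This file treats `Z` UNDER RH purely on the zero side:
§1 `(e^{2a})^ρ = e^a e^{2iaγ}`, `|m Re(e^{iθ}/ρ²)| ≤ m/|ρ|²`, `Re(1/ρ²) ≤ −1/(2|ρ|²)` (`|γ| > 14`), DIRICHLET ALIGNMENT (MV Lemma 15.10 = Literature
`exists_nat_forall_abs_sub_round_lt`): for every finite set of zeros and `a₀ > 0` some `a ≥ a₀` has `‖e^{2iaγ} − 1‖ ≤ ¼` (resp. `≤ η`) on the set;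
the aligned phase sum is `≤ −(11/64)β` (`β = Σ_ρ m/|ρ|² = 2 + γ − log 4π`); §2 `Re (∑' ρ : Zeros, (riemannZetaZeroOrder (ρ : ℂ) : ℂ) * ((((e^{2a} : ℝ)) : ℂ) ^ (ρ : ℂ) / (ρ : ℂ) ^ 2)) = e^a·(phase sum)` and **`Z(a) ≤ −(11/128)β` for arbitrarily large `a`**
(`frequently_zeroSum_le_of_RH`); §3 the sharp amplitude **`σ = Σ_ρ m(ρ)(γ² − ¼)/|ρ|⁴ ∈ [(391/392)β, β]`** and **`Z(a) ≤ −σ + δ` for arbitrarily large `a`**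
(`frequently_zeroSum_le_amp_of_RH`).  Consumers: `WeilFarFloorResidualNonzero` (the residual of C-XIII is not `o(1)`, unconditional — the `¬RH`
branch is Landau's theorem there) and `WeilFarFloorResidualAmplitude`.  Standard axioms only; RH enters as Mathlib's `RiemannHypothesis`.
-/

set_option linter.dupNamespace false
set_option autoImplicit false

noncomputable section

open MeasureTheory Set Filter Topology Complex
open scoped Real BigOperators

namespace Summit.RiemannHypothesis.RiemannHypothesis.Theorems.WeilFormatC

namespace FloorResidual

open Literature.NumberTheory.LFunctions NicolasJExplicit SchoenfeldBound

/-! ## §1 Under RH: `Y^ρ = e^a·e^{2iaγ}` for `Y = e^{2a}`, and the phase sum -/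

/-- Under RH, `(e^{2a})^ρ = e^a · exp(2aγ·i)` for a non-trivial zero `ρ = ½ + iγ`. -/
theorem cpow_zero_of_RH (hRH : RiemannHypothesis) (ρ : Zeros) (a : ℝ) :
    ((Real.exp (2 * a) : ℝ) : ℂ) ^ (ρ : ℂ) = (Real.exp a : ℂ) * cexp (((2 * a * (ρ : ℂ).im : ℝ) : ℂ) * I) := by
  have hre : (ρ : ℂ).re = 1 / 2 := re_eq_half_of_RH hRH ρ.2
  rw [Complex.cpow_def_of_ne_zero (Complex.ofReal_ne_zero.2 (Real.exp_pos _).ne'), ← Complex.ofReal_log (Real.exp_pos _).le,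
    Real.log_exp, Complex.ofReal_exp, ← Complex.exp_add]
  congr 1
  conv_lhs => rw [← Complex.re_add_im (ρ : ℂ), hre]
  push_cast
  ring

/-- The phase term `f_a(ρ) = m(ρ)·Re(e^{2iaγ}/ρ²)` and its bound `|f_a(ρ)| ≤ m(ρ)/|ρ|²`. -/
theorem abs_phaseTerm_le (ρ : Zeros) (θ : ℝ) :
    |(riemannZetaZeroOrder (ρ : ℂ) : ℝ) * (cexp ((θ : ℂ) * I) / (ρ : ℂ) ^ 2).re|
      ≤ (riemannZetaZeroOrder (ρ : ℂ) : ℝ) / ‖(ρ : ℂ)‖ ^ 2 := by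
  have hm := zeroOrder_nonneg' ρ
  rw [abs_mul, abs_of_nonneg hm, div_eq_mul_inv]
  refine mul_le_mul_of_nonneg_left ?_ hm
  calc |(cexp ((θ : ℂ) * I) / (ρ : ℂ) ^ 2).re| ≤ ‖cexp ((θ : ℂ) * I) / (ρ : ℂ) ^ 2‖ := Complex.abs_re_le_norm _
    _ = (‖(ρ : ℂ)‖ ^ 2)⁻¹ := by rw [norm_div, Complex.norm_exp_ofReal_mul_I, norm_pow, one_div]

/-- Under RH, `Re(1/ρ²) ≤ −1/(2|ρ|²)` (`Re ρ² = ¼ − γ²`, `|ρ|² = ¼ + γ²`, `|γ| > 14`). -/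
theorem re_inv_sq_le_of_RH (hRH : RiemannHypothesis) (ρ : Zeros) :
    ((1 : ℂ) / (ρ : ℂ) ^ 2).re ≤ -(1 / 2) / ‖(ρ : ℂ)‖ ^ 2 := by
  have hre : (ρ : ℂ).re = 1 / 2 := re_eq_half_of_RH hRH ρ.2
  have hγ : 14 < |(ρ : ℂ).im| := FordL33.fourteen_lt_abs_im ρ
  have hn2 : ‖(ρ : ℂ)‖ ^ 2 = 1 / 4 + (ρ : ℂ).im ^ 2 := by
    rw [← Complex.normSq_eq_norm_sq, Complex.normSq_apply, hre]; ring
  have hρ0 : 0 < ‖(ρ : ℂ)‖ ^ 2 := by rw [hn2]; positivity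
  have h196 : 196 < (ρ : ℂ).im ^ 2 := by nlinarith [abs_nonneg ((ρ : ℂ).im), sq_abs ((ρ : ℂ).im)]
  rw [one_div, Complex.inv_re, map_pow, Complex.normSq_eq_norm_sq, hn2,
    show ((ρ : ℂ) ^ 2).re = 1 / 4 - (ρ : ℂ).im ^ 2 by rw [sq, Complex.mul_re, hre]; ring,
    div_le_div_iff₀ (by positivity) (by positivity)]
  nlinarith [h196, sq_nonneg ((ρ : ℂ).im)]

/-! ## §2 The amplitude `σ` and the sharp Dirichlet alignment -/

/-- `|m·Re(1/ρ²)| ≤ m/|ρ|²`. -/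
theorem abs_ampTerm_le (ρ : Zeros) :
    |(riemannZetaZeroOrder (ρ : ℂ) : ℝ) * (-Complex.re ((1 : ℂ) / (ρ : ℂ) ^ 2))| ≤ (riemannZetaZeroOrder (ρ : ℂ) : ℝ) / ‖(ρ : ℂ)‖ ^ 2 := by
  have h := abs_phaseTerm_le ρ 0
  simp only [Complex.ofReal_zero, zero_mul, Complex.exp_zero] at h
  rw [abs_mul, abs_neg, ← abs_mul]
  exact h

/-- Under RH the amplitude series converges absolutely. -/
theorem summable_ampTerm (hRH : RiemannHypothesis) :
    Summable fun ρ : Zeros ↦ (riemannZetaZeroOrder (ρ : ℂ) : ℝ) * (-Complex.re ((1 : ℂ) / (ρ : ℂ) ^ 2)) :=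
  Summable.of_norm_bounded (hasSum_zeroOrder_div_norm_sq_of_RH hRH).summable fun ρ ↦ by
    rw [Real.norm_eq_abs]; exact abs_ampTerm_le ρ

/-- Under RH each amplitude term is at least `½·m/|ρ|²` (indeed `≥ (1 − 1/392)·m/|ρ|²`, as `|γ| > 14`). -/
theorem ampTerm_ge (hRH : RiemannHypothesis) (ρ : Zeros) :
    (391 / 392) * ((riemannZetaZeroOrder (ρ : ℂ) : ℝ) / ‖(ρ : ℂ)‖ ^ 2)
      ≤ (riemannZetaZeroOrder (ρ : ℂ) : ℝ) * (-Complex.re ((1 : ℂ) / (ρ : ℂ) ^ 2)) := by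
  have hre : (ρ : ℂ).re = 1 / 2 := re_eq_half_of_RH hRH ρ.2
  have hγ : 14 < |(ρ : ℂ).im| := FordL33.fourteen_lt_abs_im ρ
  have hn2 : ‖(ρ : ℂ)‖ ^ 2 = 1 / 4 + (ρ : ℂ).im ^ 2 := by
    rw [← Complex.normSq_eq_norm_sq, Complex.normSq_apply, hre]; ring
  have h196 : 196 < (ρ : ℂ).im ^ 2 := by nlinarith [abs_nonneg ((ρ : ℂ).im), sq_abs ((ρ : ℂ).im)]
  have hm := zeroOrder_nonneg' ρ
  have hρ0 : 0 < ‖(ρ : ℂ)‖ ^ 2 := by rw [hn2]; positivity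
  have hval : -((1 : ℂ) / (ρ : ℂ) ^ 2).re = ((ρ : ℂ).im ^ 2 - 1 / 4) / (‖(ρ : ℂ)‖ ^ 2) ^ 2 := by
    rw [one_div, Complex.inv_re, map_pow, Complex.normSq_eq_norm_sq,
      show ((ρ : ℂ) ^ 2).re = 1 / 4 - (ρ : ℂ).im ^ 2 by rw [sq, Complex.mul_re, hre]; ring]
    ring
  rw [hval, hn2, div_eq_mul_one_div (riemannZetaZeroOrder (ρ : ℂ) : ℝ), mul_comm (391 / 392 : ℝ), mul_assoc]
  refine mul_le_mul_of_nonneg_left ?_ hm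
  rw [div_mul_eq_mul_div, one_mul, div_le_div_iff₀ (by positivity) (by positivity)]
  nlinarith

/-- **`(391/392)β ≤ σ`** under RH (`β = Σ_ρ m/|ρ|²`; in particular `σ > 0.0448`). -/
theorem amp_ge (hRH : RiemannHypothesis) : (391 / 392) * nicolasBeta ≤ (∑' ρ : Zeros, (riemannZetaZeroOrder (ρ : ℂ) : ℝ) * (-Complex.re ((1 : ℂ) / (ρ : ℂ) ^ 2))) := by
  have h := (hasSum_zeroOrder_div_norm_sq_of_RH hRH)
  rw [← h.tsum_eq, ← tsum_mul_left]
  exact (h.summable.mul_left _).tsum_le_tsum (fun ρ ↦ ampTerm_ge hRH ρ) (summable_ampTerm hRH)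

/-- `σ ≤ β` under RH. -/
theorem amp_le (hRH : RiemannHypothesis) : (∑' ρ : Zeros, (riemannZetaZeroOrder (ρ : ℂ) : ℝ) * (-Complex.re ((1 : ℂ) / (ρ : ℂ) ^ 2))) ≤ nicolasBeta := by
  have h := (hasSum_zeroOrder_div_norm_sq_of_RH hRH)
  rw [← h.tsum_eq]
  exact (summable_ampTerm hRH).tsum_le_tsum (fun ρ ↦ (le_abs_self _).trans (abs_ampTerm_le ρ)) h.summable



/-- Dirichlet alignment with tolerance `η > 0`: for every finite set of zeros and `a₀ > 0` some `a ≥ a₀` has `‖e^{2iaγ} − 1‖ ≤ η` on the set. -/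
theorem exists_aligned' (s : Finset Zeros) {a₀ : ℝ} (ha₀ : 0 < a₀) {η : ℝ} (hη : 0 < η) :
    ∃ a : ℝ, a₀ ≤ a ∧ ∀ ρ ∈ s, ‖cexp (((2 * a * (ρ : ℂ).im : ℝ) : ℂ) * I) - 1‖ ≤ η := by
  classical
  obtain ⟨N, hN⟩ := exists_nat_gt (2 * π / η)
  have hN0 : 0 < N := by
    have : (0 : ℝ) < N := lt_trans (by positivity) hN
    exact_mod_cast this
  obtain ⟨n, hn0, -, hround⟩ := exists_nat_forall_abs_sub_round_lt (ι := ↥s)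
    (fun ρ ↦ a₀ * ((ρ : Zeros) : ℂ).im / π) hN0
  refine ⟨n * a₀, ?_, fun ρ hρ ↦ ?_⟩
  · have : (1 : ℝ) ≤ n := by exact_mod_cast hn0
    nlinarith
  · have h := hround ⟨ρ, hρ⟩
    set α : ℝ := a₀ * ((ρ : Zeros) : ℂ).im / π with hα
    set k : ℤ := round (α * n) with hk
    set δ : ℝ := α * n - k with hδ
    have hδb : |δ| < 1 / N := h
    have hθ : (2 * (n * a₀) * (ρ : ℂ).im : ℝ) = 2 * π * k + 2 * π * δ := by
      rw [hδ, hα]; field_simp; ring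
    rw [hθ]
    have hper : cexp (((2 * π * k + 2 * π * δ : ℝ) : ℂ) * I) = cexp (((2 * π * δ : ℝ) : ℂ) * I) := by
      rw [show ((2 * π * k + 2 * π * δ : ℝ) : ℂ) * I = (k : ℂ) * (2 * π * I) + ((2 * π * δ : ℝ) : ℂ) * I by push_cast; ring,
        Complex.exp_add, Complex.exp_int_mul_two_pi_mul_I, one_mul]
    rw [hper]
    have hNr : (0 : ℝ) < N := by exact_mod_cast hN0
    have hηN : 2 * π / N ≤ η := by
      rw [div_le_iff₀ hNr]; rw [div_lt_iff₀ hη] at hN; linarith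
    calc ‖cexp (((2 * π * δ : ℝ) : ℂ) * I) - 1‖ ≤ ‖(2 * π * δ : ℝ)‖ := by
          have := Real.norm_exp_I_mul_ofReal_sub_one_le (x := 2 * π * δ)
          rwa [mul_comm I] at this
      _ = 2 * π * |δ| := by rw [Real.norm_eq_abs, abs_mul, abs_of_pos Real.two_pi_pos]
      _ ≤ 2 * π * (1 / N) := by gcongr
      _ = 2 * π / N := by ring
      _ ≤ η := hηN

/-- The aligned phase sum with tolerance: under RH, if `β − ε ≤ sumInvNormSq T` and `‖e^{2iaγ} − 1‖ ≤ η` for the zeros with `|γ| ≤ T`, then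
`Σ_ρ m Re(e^{2iaγ}/ρ²) ≤ −σ + η·β + 2ε`. -/
theorem phaseSum_le_of_aligned' (hRH : RiemannHypothesis) {T a η ε : ℝ} (hη : 0 ≤ η) (hT : nicolasBeta - ε ≤ sumInvNormSq T)
    (hal : ∀ ρ ∈ zerosUpTo T, ‖cexp (((2 * a * (ρ : ℂ).im : ℝ) : ℂ) * I) - 1‖ ≤ η) :
    ∑' ρ : Zeros, (riemannZetaZeroOrder (ρ : ℂ) : ℝ) * (cexp (((2 * a * (ρ : ℂ).im : ℝ) : ℂ) * I) / (ρ : ℂ) ^ 2).re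
      ≤ -(∑' ρ : Zeros, (riemannZetaZeroOrder (ρ : ℂ) : ℝ) * (-Complex.re ((1 : ℂ) / (ρ : ℂ) ^ 2))) + η * nicolasBeta + 2 * ε := by
  classical
  set f : Zeros → ℝ := fun ρ ↦ (riemannZetaZeroOrder (ρ : ℂ) : ℝ) * (cexp (((2 * a * (ρ : ℂ).im : ℝ) : ℂ) * I) / (ρ : ℂ) ^ 2).re
    with hf
  set g : Zeros → ℝ := fun ρ ↦ (riemannZetaZeroOrder (ρ : ℂ) : ℝ) / ‖(ρ : ℂ)‖ ^ 2 with hg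
  set p : Zeros → ℝ := fun ρ ↦ (riemannZetaZeroOrder (ρ : ℂ) : ℝ) * (-Complex.re ((1 : ℂ) / (ρ : ℂ) ^ 2)) with hp
  -- majorant: on the aligned set `−p + η g`, beyond it `g`; and `−p ≤ g − 2g·(391/392) ≤ ...` is not needed: off the set use `|f| ≤ g`
  set h : Zeros → ℝ := fun ρ ↦ if ρ ∈ zerosUpTo T then -p ρ + η * g ρ else g ρ with hh
  have hgs : Summable g := (hasSum_zeroOrder_div_norm_sq_of_RH hRH).summable
  have hps : Summable p := summable_ampTerm hRH
  have hfs : Summable f :=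
    Summable.of_norm_bounded hgs fun ρ ↦ by rw [Real.norm_eq_abs]; exact abs_phaseTerm_le ρ _
  have hfh : ∀ ρ, f ρ ≤ h ρ := by
    intro ρ
    by_cases hρ : ρ ∈ zerosUpTo T
    · simp only [hh, if_pos hρ, hp, hg, hf]
      have hm := zeroOrder_nonneg' ρ
      have hρ0 : 0 < ‖(ρ : ℂ)‖ ^ 2 := by have := FordL33.fourteen_lt_norm ρ; positivity
      have hsplit : cexp (((2 * a * (ρ : ℂ).im : ℝ) : ℂ) * I) / (ρ : ℂ) ^ 2
          = 1 / (ρ : ℂ) ^ 2 + (cexp (((2 * a * (ρ : ℂ).im : ℝ) : ℂ) * I) - 1) / (ρ : ℂ) ^ 2 := by ring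
      have h2 : ((cexp (((2 * a * (ρ : ℂ).im : ℝ) : ℂ) * I) - 1) / (ρ : ℂ) ^ 2).re ≤ η / ‖(ρ : ℂ)‖ ^ 2 := by
        calc ((cexp (((2 * a * (ρ : ℂ).im : ℝ) : ℂ) * I) - 1) / (ρ : ℂ) ^ 2).re
            ≤ ‖(cexp (((2 * a * (ρ : ℂ).im : ℝ) : ℂ) * I) - 1) / (ρ : ℂ) ^ 2‖ := Complex.re_le_norm _
          _ = ‖cexp (((2 * a * (ρ : ℂ).im : ℝ) : ℂ) * I) - 1‖ / ‖(ρ : ℂ)‖ ^ 2 := by rw [norm_div, norm_pow]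
          _ ≤ η / ‖(ρ : ℂ)‖ ^ 2 := div_le_div_of_nonneg_right (hal ρ hρ) hρ0.le
      rw [hsplit, Complex.add_re]
      calc (riemannZetaZeroOrder (ρ : ℂ) : ℝ) * (((1 : ℂ) / (ρ : ℂ) ^ 2).re + ((cexp (((2 * a * (ρ : ℂ).im : ℝ) : ℂ) * I) - 1) / (ρ : ℂ) ^ 2).re)
          ≤ (riemannZetaZeroOrder (ρ : ℂ) : ℝ) * (((1 : ℂ) / (ρ : ℂ) ^ 2).re + η / ‖(ρ : ℂ)‖ ^ 2) :=
            mul_le_mul_of_nonneg_left (add_le_add le_rfl h2) hm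
        _ = -((riemannZetaZeroOrder (ρ : ℂ) : ℝ) * (-Complex.re ((1 : ℂ) / (ρ : ℂ) ^ 2)))
            + η * ((riemannZetaZeroOrder (ρ : ℂ) : ℝ) / ‖(ρ : ℂ)‖ ^ 2) := by ring
    · simp only [hh, if_neg hρ]; exact (le_abs_self _).trans (abs_phaseTerm_le ρ _)
  -- the sum of the majorant
  have hfinP : HasSum (fun ρ : Zeros ↦ if ρ ∈ zerosUpTo T then -p ρ + η * g ρ else 0)
      (∑ ρ ∈ zerosUpTo T, (-p ρ + η * g ρ)) := by
    have h1 : HasSum (fun ρ : Zeros ↦ if ρ ∈ zerosUpTo T then -p ρ + η * g ρ else 0)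
        (∑ ρ ∈ zerosUpTo T, (if ρ ∈ zerosUpTo T then -p ρ + η * g ρ else 0)) :=
      hasSum_sum_of_ne_finset_zero (fun ρ hρ ↦ if_neg hρ)
    rwa [Finset.sum_congr rfl fun ρ hρ ↦ if_pos hρ] at h1
  have htail := hasSum_tail_of_RH hRH T
  have hhs : HasSum h ((∑ ρ ∈ zerosUpTo T, (-p ρ + η * g ρ)) + (nicolasBeta - sumInvNormSq T)) := by
    have hfun : h = fun ρ ↦ (if ρ ∈ zerosUpTo T then -p ρ + η * g ρ else 0)
        + (if ρ ∈ zerosUpTo T then 0 else (riemannZetaZeroOrder (ρ : ℂ) : ℝ) / ‖(ρ : ℂ)‖ ^ 2) := by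
      funext ρ
      by_cases hρ : ρ ∈ zerosUpTo T <;> simp [hh, hg, hρ]
    rw [hfun]
    exact hfinP.add htail
  -- the finite part: `Σ_s (−p + ηg) = −Σ_s p + η·sumInvNormSq T ≤ −(σ − tail of p) + ηβ`, tail of `p` ≤ tail of `g` = β − sumInvNormSq ≤ ε
  have hsum_fin : ∑ ρ ∈ zerosUpTo T, (-p ρ + η * g ρ) = -(∑ ρ ∈ zerosUpTo T, p ρ) + η * sumInvNormSq T := by
    rw [Finset.sum_add_distrib, Finset.sum_neg_distrib, sumInvNormSq, Finset.mul_sum]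
  -- `σ − Σ_s p = Σ_{∉ s} p ≤ Σ_{∉ s} g = β − sumInvNormSq T`
  have hptail : (∑' ρ : Zeros, (riemannZetaZeroOrder (ρ : ℂ) : ℝ) * (-Complex.re ((1 : ℂ) / (ρ : ℂ) ^ 2))) - ∑ ρ ∈ zerosUpTo T, p ρ ≤ nicolasBeta - sumInvNormSq T := by
    have hp' : HasSum (fun ρ : Zeros ↦ if ρ ∈ zerosUpTo T then 0 else p ρ) ((∑' ρ : Zeros, (riemannZetaZeroOrder (ρ : ℂ) : ℝ) * (-Complex.re ((1 : ℂ) / (ρ : ℂ) ^ 2))) - ∑ ρ ∈ zerosUpTo T, p ρ) := by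
      have hall := hps.hasSum
      have hfin : HasSum (fun ρ : Zeros ↦ if ρ ∈ zerosUpTo T then p ρ else 0) (∑ ρ ∈ zerosUpTo T, p ρ) := by
        have h1 : HasSum (fun ρ : Zeros ↦ if ρ ∈ zerosUpTo T then p ρ else 0)
            (∑ ρ ∈ zerosUpTo T, (if ρ ∈ zerosUpTo T then p ρ else 0)) := hasSum_sum_of_ne_finset_zero (fun ρ hρ ↦ if_neg hρ)
        rwa [Finset.sum_congr rfl fun ρ hρ ↦ if_pos hρ] at h1
      have hfun : (fun ρ : Zeros ↦ if ρ ∈ zerosUpTo T then 0 else p ρ) = fun ρ ↦ p ρ - (if ρ ∈ zerosUpTo T then p ρ else 0) := by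
        funext ρ; by_cases hρ : ρ ∈ zerosUpTo T <;> simp [hρ]
      rw [hfun]
      exact hall.sub hfin
    refine hasSum_le (fun ρ ↦ ?_) hp' htail
    by_cases hρ : ρ ∈ zerosUpTo T
    · simp [hρ]
    · simp only [if_neg hρ]; exact (le_abs_self _).trans (abs_ampTerm_le ρ)
  have hβT : sumInvNormSq T ≤ nicolasBeta := sumInvNormSq_le_nicolasBeta hRH T
  calc ∑' ρ, f ρ ≤ ∑' ρ, h ρ := hfs.tsum_le_tsum hfh hhs.summable
    _ = (∑ ρ ∈ zerosUpTo T, (-p ρ + η * g ρ)) + (nicolasBeta - sumInvNormSq T) := hhs.tsum_eq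
    _ ≤ -(∑' ρ : Zeros, (riemannZetaZeroOrder (ρ : ℂ) : ℝ) * (-Complex.re ((1 : ℂ) / (ρ : ℂ) ^ 2))) + η * nicolasBeta + 2 * ε := by rw [hsum_fin]; nlinarith [hptail, hβT, hT]

/-- There is a height `T` with `sumInvNormSq T ≥ β − ε` (`ε > 0`; under RH). -/
theorem exists_height' (hRH : RiemannHypothesis) {ε : ℝ} (hε : 0 < ε) : ∃ T : ℝ, nicolasBeta - ε ≤ sumInvNormSq T := by
  classical
  have hall := hasSum_zeroOrder_div_norm_sq_of_RH hRH
  have hev := (hall.eventually (Ioi_mem_nhds (show nicolasBeta - ε < nicolasBeta by linarith)))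
  obtain ⟨F₀, hF₀⟩ := Filter.eventually_atTop.1 hev
  refine ⟨∑ ρ ∈ F₀, |((ρ : Zeros) : ℂ).im|, ?_⟩
  have hsub : F₀ ⊆ zerosUpTo (∑ ρ ∈ F₀, |((ρ : Zeros) : ℂ).im|) := fun ρ hρ ↦
    mem_zerosUpTo.2 (Finset.single_le_sum (f := fun ρ : Zeros ↦ |((ρ : Zeros) : ℂ).im|) (fun _ _ ↦ abs_nonneg _) hρ)
  calc nicolasBeta - ε ≤ ∑ ρ ∈ F₀, (riemannZetaZeroOrder (ρ : ℂ) : ℝ) / ‖(ρ : ℂ)‖ ^ 2 := (hF₀ F₀ le_rfl).le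
    _ ≤ sumInvNormSq _ := Finset.sum_le_sum_of_subset_of_nonneg hsub fun ρ _ _ ↦ div_nonneg (zeroOrder_nonneg' ρ) (sq_nonneg _)



/-! ## §3 The crude constants used by `WeilFarFloorResidualNonzero` (derived from §2) -/

/-- Dirichlet alignment with tolerance `¼`. -/
theorem exists_aligned (s : Finset Zeros) {a₀ : ℝ} (ha₀ : 0 < a₀) :
    ∃ a : ℝ, a₀ ≤ a ∧ ∀ ρ ∈ s, ‖cexp (((2 * a * (ρ : ℂ).im : ℝ) : ℂ) * I) - 1‖ ≤ 1 / 4 :=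
  exists_aligned' s ha₀ (by norm_num)

/-- A height `T` with `sumInvNormSq T ≥ (15/16)β` (under RH). -/
theorem exists_height (hRH : RiemannHypothesis) : ∃ T : ℝ, 15 / 16 * nicolasBeta ≤ sumInvNormSq T := by
  have hβ : 0 < nicolasBeta := lt_trans (by norm_num) nicolasBeta_gt
  obtain ⟨T, hT⟩ := exists_height' hRH (show 0 < nicolasBeta / 16 by positivity)
  exact ⟨T, by linarith⟩

/-- **The aligned phase sum is negative** (under RH): if `sumInvNormSq T ≥ (15/16)β` and the phases of the zeros with `|γ| ≤ T` are aligned at `a`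
(`‖e^{2iaγ} − 1‖ ≤ ¼`), then `Σ_ρ m(ρ)·Re(e^{2iaγ}/ρ²) ≤ −(11/64)β` (indeed `≤ −σ + β/4 + β/8 ≤ −(243/392)β`). -/
theorem phaseSum_le_of_aligned (hRH : RiemannHypothesis) {T a : ℝ} (hT : 15 / 16 * nicolasBeta ≤ sumInvNormSq T)
    (hal : ∀ ρ ∈ zerosUpTo T, ‖cexp (((2 * a * (ρ : ℂ).im : ℝ) : ℂ) * I) - 1‖ ≤ 1 / 4) :
    ∑' ρ : Zeros, (riemannZetaZeroOrder (ρ : ℂ) : ℝ) * (cexp (((2 * a * (ρ : ℂ).im : ℝ) : ℂ) * I) / (ρ : ℂ) ^ 2).re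
      ≤ -(11 / 64) * nicolasBeta := by
  have h := phaseSum_le_of_aligned' hRH (by norm_num : (0 : ℝ) ≤ 1 / 4) (ε := nicolasBeta / 16) (by linarith) hal
  have hσ := amp_ge hRH
  have hβ : 0 < nicolasBeta := lt_trans (by norm_num) nicolasBeta_gt
  linarith

/-! ## §4 `Re (∑' ρ : Zeros, (riemannZetaZeroOrder (ρ : ℂ) : ℂ) * ((((e^{2a} : ℝ)) : ℂ) ^ (ρ : ℂ) / (ρ : ℂ) ^ 2)) = e^a·(phase sum)`; `Z(a) ≤ −(11/128)β` and `Z(a) ≤ −σ + δ` for arbitrarily large `a` -/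

/-- Under RH, `Re Σ_ρ m(ρ)(e^{2a})^ρ/ρ² = e^a · Σ_ρ m(ρ)Re(e^{2iaγ}/ρ²)`. -/
theorem re_zsq_of_RH (hRH : RiemannHypothesis) (a : ℝ) :
    ((∑' ρ : Zeros, (riemannZetaZeroOrder (ρ : ℂ) : ℂ) * ((((Real.exp (2 * a) : ℝ)) : ℂ) ^ (ρ : ℂ) / (ρ : ℂ) ^ 2))).re
      = Real.exp a * ∑' ρ : Zeros, (riemannZetaZeroOrder (ρ : ℂ) : ℝ) * (cexp (((2 * a * (ρ : ℂ).im : ℝ) : ℂ) * I) / (ρ : ℂ) ^ 2).re := by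
  have hterm : ∀ ρ : Zeros, (riemannZetaZeroOrder (ρ : ℂ) : ℂ) * ((((Real.exp (2 * a)) : ℝ) : ℂ) ^ (ρ : ℂ) / (ρ : ℂ) ^ 2)
      = (Real.exp a : ℂ) * (((riemannZetaZeroOrder (ρ : ℂ) : ℝ) : ℂ) * (cexp (((2 * a * (ρ : ℂ).im : ℝ) : ℂ) * I) / (ρ : ℂ) ^ 2)) := by
    intro ρ
    rw [cpow_zero_of_RH hRH ρ a, Complex.ofReal_intCast]
    ring
  have hs : Summable fun ρ : Zeros ↦ ((riemannZetaZeroOrder (ρ : ℂ) : ℝ) : ℂ) * (cexp (((2 * a * (ρ : ℂ).im : ℝ) : ℂ) * I) / (ρ : ℂ) ^ 2) := by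
    refine Summable.of_norm_bounded (hasSum_zeroOrder_div_norm_sq_of_RH hRH).summable fun ρ ↦ ?_
    rw [norm_mul, Complex.norm_real, Real.norm_eq_abs, abs_of_nonneg (zeroOrder_nonneg' ρ), norm_div,
      Complex.norm_exp_ofReal_mul_I, norm_pow]
    exact le_of_eq (by ring)
  rw [tsum_congr hterm, tsum_mul_left, Complex.re_ofReal_mul, Complex.re_tsum hs]
  congr 1
  exact tsum_congr fun ρ ↦ by rw [Complex.re_ofReal_mul]

/-- Under RH, at an aligned `a ≥ 0` (phases of the zeros below a height `T` with `sumInvNormSq T ≥ (15/16)β` aligned),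
`Z(a) = Re (∑' ρ : Zeros, (riemannZetaZeroOrder (ρ : ℂ) : ℂ) * ((((e^{2a} : ℝ)) : ℂ) ^ (ρ : ℂ) / (ρ : ℂ) ^ 2))/(2(a + sinh a)) ≤ −(11/128)β` (`e^a ≥ a + sinh a`). -/
theorem zeroSum_le_of_aligned (hRH : RiemannHypothesis) {T a : ℝ} (ha : 0 < a) (hT : 15 / 16 * nicolasBeta ≤ sumInvNormSq T)
    (hal : ∀ ρ ∈ zerosUpTo T, ‖cexp (((2 * a * (ρ : ℂ).im : ℝ) : ℂ) * I) - 1‖ ≤ 1 / 4) :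
    ((∑' ρ : Zeros, (riemannZetaZeroOrder (ρ : ℂ) : ℂ) * ((((Real.exp (2 * a) : ℝ)) : ℂ) ^ (ρ : ℂ) / (ρ : ℂ) ^ 2))).re / (2 * (a + Real.sinh a)) ≤ -(11 / 128) * nicolasBeta := by
  rw [re_zsq_of_RH hRH a]
  have hS := phaseSum_le_of_aligned hRH hT hal
  have hβ : 0 < nicolasBeta := lt_trans (by norm_num) nicolasBeta_gt
  have hsinh : a ≤ Real.sinh a := Real.self_le_sinh_iff.2 ha.le
  have hD : 0 < a + Real.sinh a := by have := Real.sinh_pos_iff.2 ha; linarith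
  have hED : a + Real.sinh a ≤ Real.exp a := by
    have h2 := Real.sinh_lt_cosh a
    have h3 := Real.cosh_add_sinh a
    linarith
  rw [div_le_iff₀ (by linarith)]
  nlinarith [Real.exp_pos a, hS, hED]

/-- **Under RH, `Z(a) ≤ −(11/128)β` for arbitrarily large `a`.** -/
theorem frequently_zeroSum_le_of_RH (hRH : RiemannHypothesis) :
    ∃ᶠ a : ℝ in atTop, ((∑' ρ : Zeros, (riemannZetaZeroOrder (ρ : ℂ) : ℂ) * ((((Real.exp (2 * a) : ℝ)) : ℂ) ^ (ρ : ℂ) / (ρ : ℂ) ^ 2))).re / (2 * (a + Real.sinh a)) ≤ -(11 / 128) * nicolasBeta := by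
  obtain ⟨T, hT⟩ := exists_height hRH
  refine frequently_atTop.2 fun a₀ ↦ ?_
  obtain ⟨a, ha, hal⟩ := exists_aligned (zerosUpTo T) (a₀ := max a₀ 1) (by positivity)
  exact ⟨a, (le_max_left _ _).trans ha, zeroSum_le_of_aligned hRH (by linarith [le_max_right a₀ 1]) hT hal⟩

/-- **Under RH, `Z(a) ≤ −σ + δ` for arbitrarily large `a`** (every `δ > 0`). -/
theorem frequently_zeroSum_le_amp_of_RH (hRH : RiemannHypothesis) {δ : ℝ} (hδ : 0 < δ) :
    ∃ᶠ a : ℝ in atTop, ((∑' ρ : Zeros, (riemannZetaZeroOrder (ρ : ℂ) : ℂ) * ((((Real.exp (2 * a) : ℝ)) : ℂ) ^ (ρ : ℂ) / (ρ : ℂ) ^ 2))).re / (2 * (a + Real.sinh a)) ≤ -(∑' ρ : Zeros, (riemannZetaZeroOrder (ρ : ℂ) : ℝ) * (-Complex.re ((1 : ℂ) / (ρ : ℂ) ^ 2))) + δ := by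
  have hβ : 0 < nicolasBeta := lt_trans (by norm_num) nicolasBeta_gt
  have hσβ := amp_le hRH
  have hσ0 : 0 < (∑' ρ : Zeros, (riemannZetaZeroOrder (ρ : ℂ) : ℝ) * (-Complex.re ((1 : ℂ) / (ρ : ℂ) ^ 2))) := lt_of_lt_of_le (by nlinarith [nicolasBeta_gt]) (amp_ge hRH)
  -- parameters: `ε = δ/8`, `η = δ/(8β)`; then `−σ + ηβ + 2ε = −σ + 3δ/8`
  obtain ⟨T, hT⟩ := exists_height' hRH (show 0 < δ / 8 by positivity)
  -- `e^a/(2(a + sinh a)) → 1`: eventually `≥ 1 − δ/(8σ)`-type control; we use `2(a + sinh a) ≤ e^a + 2a` and `(2a)·σ/e^a ≤ δ/2` eventually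
  have hev : ∀ᶠ a : ℝ in atTop, 2 * a * nicolasBeta ≤ δ / 4 * Real.exp a := by
    have h := (Real.tendsto_pow_mul_exp_neg_atTop_nhds_zero 1).eventually (Iio_mem_nhds (show (0 : ℝ) < δ / (8 * nicolasBeta) by positivity))
    filter_upwards [h, eventually_ge_atTop 0] with a ha ha0
    simp only [pow_one] at ha
    rw [lt_div_iff₀ (by positivity)] at ha
    have hE := Real.exp_pos a
    have : a * Real.exp (-a) * Real.exp a = a := by rw [mul_assoc, ← Real.exp_add]; simp
    nlinarith [this]
  refine frequently_atTop.2 fun a₀ ↦ ?_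
  obtain ⟨a₁, ha₁⟩ := Filter.eventually_atTop.1 hev
  obtain ⟨a, ha, hal⟩ := exists_aligned' (zerosUpTo T) (a₀ := max (max a₀ a₁) 1) (by positivity)
    (show 0 < δ / (8 * nicolasBeta) by positivity)
  refine ⟨a, ((le_max_left _ _).trans (le_max_left _ _)).trans ha, ?_⟩
  have ha1 : 1 ≤ a := (le_max_right _ _).trans ha
  have haev := ha₁ a (((le_max_right _ _).trans (le_max_left _ _)).trans ha)
  have hS := phaseSum_le_of_aligned' hRH (by positivity) hT hal
  rw [re_zsq_of_RH hRH a]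
  have hsinh : a ≤ Real.sinh a := Real.self_le_sinh_iff.2 (by linarith)
  have hD : 0 < a + Real.sinh a := by have := Real.sinh_pos_iff.2 (show 0 < a by linarith); linarith
  have hED : a + Real.sinh a ≤ Real.exp a := by
    have h2 := Real.sinh_lt_cosh a; have h3 := Real.cosh_add_sinh a; linarith
  have h2D : Real.exp a ≤ 2 * (a + Real.sinh a) + 0 ∧ 2 * (a + Real.sinh a) ≤ Real.exp a + 2 * a := by
    constructor
    · rw [Real.sinh_eq]; have := Real.exp_le_one_iff.2 (show -a ≤ 0 by linarith); linarith
    · rw [Real.sinh_eq]; have := Real.exp_pos (-a); linarith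
  have hval : δ / (8 * nicolasBeta) * nicolasBeta = δ / 8 := by field_simp
  rw [hval] at hS
  -- `e^a · S ≤ (−σ + 3δ/8) e^a`; want `≤ (−σ + δ)·2D`; since `2D ≤ e^a + 2a` and `σ ≤ β`, `(−σ+δ)2D ≥ (−σ+δ)... ` handle signs:
  rw [div_le_iff₀ (by linarith)]
  have hE := Real.exp_pos a
  nlinarith [hS, h2D.1, h2D.2, haev, hσβ, hσ0.le, mul_le_mul_of_nonneg_left hS hE.le]


end FloorResidual

end Summit.RiemannHypothesis.RiemannHypothesis.Theorems.WeilFormatC
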